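import Mathlib.Analysis.SpecialFunctions.Pow.Real
import Mathlib.Analysis.SpecialFunctions.Sqrt
import Mathlib.Topology.Order.DenselyOrdered
import HarnessLib

/-!
# Decay of `|∇Rm|²` for a roundening Type-I Ricci flow — the maximum-principle bookkeeping
(helper file for `helper_curvDeriv_decay_one` = layer S3b of stub `stub_smoothRoundLimit`, line
`margerin-cone-hamilton-rails`, crux `EntropyRung.ChangGurskyYang`, item stmt-SmoothPoincare4-10834;
registered helper `helper_curvDeriv_decayWindow`)

Hamilton 1982, §17, Thm. 17.6 for `k = 1` in squared form, `|∇Rm|² ≤ C₁(T−t)^{δ₁−3}`, for a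
Ricci flow on a closed 4-manifold that becomes round at the rates `|hR − 2| ≤ Ch^δ`, `h²|E|² ≤ Ch^{2δ}`, `h²|W|² ≤ Ch^δ` (`h = T − t`), in MAXIMUM-PRINCIPLE
form: everything geometric is abstracted into real functions on `[0, T) × α` — the scalar
curvature `R`, `N = |Ric|²`, `Q = |Rm|²`, the round defect `P = Q − 2R/(3h) + 2/(3h²)`
(`= |W|² + 2|E|² + (hR−2)²/(6h²) ≥ 0`, `roundDefect_eq`), `F₁ = |∇Rm|²` and the reaction terms
`Φf`, `ΦF` of the two evolution inequalities `∂ₜP ≤ ΔP − 2F₁ + Φf`, `∂ₜF₁ ≤ ΔF₁ + ΦF` — and the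
only analytic input is the Bernstein window lemma (Topping 2006, proof of Thm. 3.3.1: the maximum
principle for `(t − t₁)F₁ + θ⁻¹·P`-type quantities on a window `[t₁, t₁ + τ]` with `Kτ ≤ 1`),
taken as a hypothesis for the pair `(P, F₁)` with `θ = 2`.

* `roundDefect_eq`, `roundDefect_nonneg`, `roundDefect_le` — the round defect is a sum of
  squares, hence `≥ 0`, and `≤ C_P u²/h²` under the rates (`u = h^{δ₁}`, `δ₁ = min δ 1 / 2`);
* `roundDefect_reaction_le` — `C₂(Q + h⁻²)√|P| + C₂√Q|P| ≤ C_a u/h³`;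
* `helper_curvDeriv_decayWindow` — the endgame: on the window `[t₁, t₁ + κh₁]`, `h₁ = T − t₁ ≤ 1`,
  `κ = min ½ (1/(6C_s√C_Q + 1))`, the window lemma with `A₀ = C_P u₁²/h₁²`, `a = 8C_a u₁/h₁³`,
  `K = 6C_s√C_Q/h₁`, `b = 0` gives `κh₁³F₁(t₁ + κh₁) ≤ (C_P + 8C_a)u₁`, and every late time is the
  end of such a window: `F₁ ≤ (2(C_P + 8C_a)/κ) h^{δ₁−3}`.

## References

* R. S. Hamilton, *Three-manifolds with positive Ricci curvature*, J. Differential Geom. 17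
  (1982) 255–306, §17, Thm. 17.6 (with §13, Thm. 13.4 ff.). [Hamilton1982]
* P. Topping, *Lectures on the Ricci flow*, LMS Lecture Note Series 325, CUP 2006, §3.3,
  Thm. 3.3.1 and its proof (pp. 37–39). [Topping2006]
-/

noncomputable section

-- every `Summit.SmoothPoincare4.SmoothPoincare4.…` name repeats the summit = sub-problem segment (D-0017 layout)
set_option linter.dupNamespace false

open Set

namespace Summit.SmoothPoincare4.SmoothPoincare4.Theorems.MargerinRails

/-! ### Real-variable lemmas: the round defect and the reaction terms -/

section RealLemmas

/-- **The round defect is a sum of squares**: with `h ≠ 0`,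
`|Rm|² − 2R/(3h) + 2/(3h²) = |W|² + 2|E|² + (hR − 2)²/(6h²)`, where `|W|² = |Rm|² − 2|Ric|² + R²/3`
and `|E|² = |Ric|² − R²/4` (Hamilton 1982, §17, proof of Thm. 17.6: the pinching quantity measuring
the distance from the round shrinking state `E = 0`, `W = 0`, `R = 2/(T − t)` in dimension 4).
[cite: Hamilton1982, §17, Thm. 17.6] -/
theorem roundDefect_eq {h R N Q : ℝ} (hh : h ≠ 0) :
    Q - 2 * R / (3 * h) + 2 / (3 * h ^ 2) =
      (h ^ 2 * (Q - 2 * N + R ^ 2 / 3) + 2 * (h ^ 2 * (N - R ^ 2 / 4)) + (h * R - 2) ^ 2 / 6) /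
        h ^ 2 := by
  field_simp
  ring

/-- **The round defect is nonnegative** (`|W|², |E|² ≥ 0`). [cite: Hamilton1982, §17, Thm. 17.6] -/
theorem roundDefect_nonneg {h R N Q : ℝ} (hh : 0 < h) (hE : 0 ≤ N - R ^ 2 / 4)
    (hW : 0 ≤ Q - 2 * N + R ^ 2 / 3) : 0 ≤ Q - 2 * R / (3 * h) + 2 / (3 * h ^ 2) := by
  rw [roundDefect_eq (N := N) hh.ne']
  exact div_nonneg (add_nonneg (add_nonneg (mul_nonneg (sq_nonneg h) hW)
    (mul_nonneg zero_le_two (mul_nonneg (sq_nonneg h) hE))) (div_nonneg (sq_nonneg _) (by norm_num)))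
    (sq_nonneg h)

/-- **Smallness of the round defect under the roundness rates** (Hamilton 1982, §17, Thm. 17.6,
step 1): if `|hR − 2| ≤ C u²`, `h²|E|² ≤ C u²`, `h²|W|² ≤ C u²` with `0 ≤ u ≤ 1`, `C ≥ 0`, then
`|Rm|² − 2R/(3h) + 2/(3h²) ≤ (3C + C²/6) u²/h²`. [cite: Hamilton1982, §17, Thm. 17.6] -/
theorem roundDefect_le {h u R N Q C : ℝ} (hh : 0 < h) (hu0 : 0 ≤ u) (hu1 : u ≤ 1)
    (h1 : |h * R - 2| ≤ C * u ^ 2) (h2 : h ^ 2 * (N - R ^ 2 / 4) ≤ C * u ^ 2)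
    (h3 : h ^ 2 * (Q - 2 * N + R ^ 2 / 3) ≤ C * u ^ 2) :
    Q - 2 * R / (3 * h) + 2 / (3 * h ^ 2) ≤ (3 * C + C ^ 2 / 6) * u ^ 2 / h ^ 2 := by
  rw [roundDefect_eq (N := N) hh.ne']
  refine div_le_div_of_nonneg_right ?_ (sq_nonneg h)
  have hsq : (h * R - 2) ^ 2 ≤ (C * u ^ 2) ^ 2 := by
    calc (h * R - 2) ^ 2 = |h * R - 2| ^ 2 := (sq_abs _).symm
      _ ≤ (C * u ^ 2) ^ 2 := pow_le_pow_left₀ (abs_nonneg _) h1 2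
  have hu2 : u ^ 2 ≤ 1 := pow_le_one₀ hu0 hu1
  have hC2 : (C * u ^ 2) ^ 2 ≤ C ^ 2 * u ^ 2 := by
    have : (C * u ^ 2) ^ 2 = C ^ 2 * u ^ 2 * u ^ 2 := by ring
    rw [this]
    exact mul_le_of_le_one_right (by positivity) hu2
  nlinarith [h2, h3, hsq, hC2]

/-- **The reaction terms of the round defect are integrable in scale** (Hamilton 1982, §17,
Thm. 17.6, step 2): with `0 ≤ P ≤ C_P u²/h²`, `0 ≤ Q ≤ C_Q/h²`, `0 ≤ u ≤ 1`,
`C₂ (Q + h⁻²) √|P| + C₂ √Q |P| ≤ C_a u/h³`, `C_a = C₂(C_Q + 1)√C_P + C₂ √C_Q C_P`.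
[cite: Hamilton1982, §17, Thm. 17.6] -/
theorem roundDefect_reaction_le {h u P Q C₂ CP CQ : ℝ} (hh : 0 < h) (hu0 : 0 ≤ u) (hu1 : u ≤ 1)
    (hC₂ : 0 ≤ C₂) (hCP : 0 ≤ CP) (hCQ : 0 ≤ CQ) (hP0 : 0 ≤ P) (hP : P ≤ CP * u ^ 2 / h ^ 2)
    (hQ : Q ≤ CQ * (h ^ 2)⁻¹) :
    C₂ * (Q + (h ^ 2)⁻¹) * √|P| + C₂ * √Q * |P| ≤
      (C₂ * (CQ + 1) * √CP + C₂ * √CQ * CP) * u / h ^ 3 := by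
  have hh0 : h ≠ 0 := hh.ne'
  rw [abs_of_nonneg hP0]
  have hsP : √P ≤ √CP * u / h := by
    rw [Real.sqrt_le_left (by positivity)]
    calc P ≤ CP * u ^ 2 / h ^ 2 := hP
      _ = (√CP * u / h) ^ 2 := by rw [div_pow, mul_pow, Real.sq_sqrt hCP]
  have hsQ : √Q ≤ √CQ / h := by
    rw [Real.sqrt_le_left (by positivity)]
    calc Q ≤ CQ * (h ^ 2)⁻¹ := hQ
      _ = (√CQ / h) ^ 2 := by rw [div_pow, Real.sq_sqrt hCQ, div_eq_mul_inv]
  have hQ' : Q ≤ CQ / h ^ 2 := by rwa [div_eq_mul_inv]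
  have hQ1 : Q + (h ^ 2)⁻¹ ≤ (CQ + 1) / h ^ 2 := by
    rw [add_div, one_div]
    exact add_le_add hQ' le_rfl
  have hPu : P ≤ CP * u / h ^ 2 := by
    refine hP.trans (div_le_div_of_nonneg_right ?_ (sq_nonneg h))
    nlinarith [mul_le_mul_of_nonneg_left hu1 (mul_nonneg hCP hu0)]
  have t1 : C₂ * (Q + (h ^ 2)⁻¹) * √P ≤ C₂ * ((CQ + 1) / h ^ 2) * (√CP * u / h) :=
    mul_le_mul (mul_le_mul_of_nonneg_left hQ1 hC₂) hsP (Real.sqrt_nonneg _) (by positivity)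
  have t2 : C₂ * √Q * P ≤ C₂ * (√CQ / h) * (CP * u / h ^ 2) :=
    mul_le_mul (mul_le_mul_of_nonneg_left hsQ hC₂) hPu hP0 (by positivity)
  calc C₂ * (Q + (h ^ 2)⁻¹) * √P + C₂ * √Q * P
        ≤ C₂ * ((CQ + 1) / h ^ 2) * (√CP * u / h) + C₂ * (√CQ / h) * (CP * u / h ^ 2) :=
      add_le_add t1 t2
    _ = (C₂ * (CQ + 1) * √CP + C₂ * √CQ * CP) * u / h ^ 3 := by
      field_simp

end RealLemmas

/-! ### The maximum-principle endgame (abstract form) -/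

section Endgame

/-- **Hamilton 1982, §17, Thm. 17.6 for `k = 1`, maximum-principle form — the endgame.** Abstract
bookkeeping behind `helper_curvDeriv_decay_one` (registered helper `helper_curvDeriv_decayWindow`): `R, N, Q` (scalar curvature, `|Ric|²`, `|Rm|²`),
the round defect `P = Q − 2R/(3h) + 2/(3h²)` (`h = T − t`), `F₁ = |∇Rm|²` and the two reaction
terms `Φf, ΦF` are arbitrary real functions on `[0, T) × α` subject to: the roundness rates on
`[t₀, T)`, `|E|², |W|² ≥ 0`, the curvature scale `Q ≤ C_Q h⁻²` on `[t_Q, T)`, `F₁ ≥ 0`,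
`Φf ≤ C₂(Q + h⁻²)√|P| + C₂√Q|P|`, `ΦF ≤ 3C_s√Q F₁`, and the Bernstein window lemma for the pair
`(P, F₁)` with `θ = 2`. Then `F₁ ≤ C₁ h^{δ₁−3}` on some `[t₁, T)` with `δ₁ = min δ 1 / 2 > 0`.
Proof: on `[s₀, T)`, `s₀ = max t₀ t_Q (T−1)`, one has `P ≤ C_P u²/h²` and `Φf ≤ C_a u/h³`
(`u = h^{δ₁} ≤ 1`; `roundDefect_le`, `roundDefect_reaction_le`); on the window
`[t₁, t₁ + κh₁]`, `h₁ = T − t₁`, `κ = min ½ (1/(6C_s√C_Q + 1))`, the window lemma with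
`A₀ = C_P u₁²/h₁²`, `a = 8C_a u₁/h₁³`, `K = 6C_s√C_Q/h₁`, `b = 0` gives
`κh₁³ F₁(t₁ + κh₁) ≤ (C_P + 8C_a) u₁`; every `t ≥ s₀ + κ(T − s₀)` is `t₁ + κh₁` with
`h ≤ h₁ ≤ 2h`. [cite: Hamilton1982, §17, Thm. 17.6] [cite: Topping2006, Thm. 3.3.1] -/
theorem helper_curvDeriv_decayWindow : ∀ (α : Type) (T δ C t₀ tQ CQ C₂ Cs : ℝ) (R N Q P F₁ Φf ΦF : ℝ → α → ℝ), 0 < δ → t₀ ∈ Ico 0 T → tQ ∈ Ico 0 T → 0 ≤ C₂ → 0 ≤ Cs → (∀ t ∈ Ico t₀ T, ∀ x : α, |(T - t) * R t x - 2| ≤ C * (T - t) ^ δ ∧ (T - t) ^ 2 * (N t x - R t x ^ 2 / 4) ≤ C * (T - t) ^ (2 * δ) ∧ (T - t) ^ 2 * (Q t x - 2 * N t x + R t x ^ 2 / 3) ≤ C * (T - t) ^ δ) → (∀ t ∈ Ico tQ T, ∀ x : α, Q t x ≤ CQ * ((T - t) ^ 2)⁻¹) → (∀ (t : ℝ) (x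 : α), P t x = Q t x - 2 * R t x / (3 * (T - t)) + 2 / (3 * (T - t) ^ 2)) → (∀ t ∈ Ico 0 T, ∀ x : α, 0 ≤ P t x) → (∀ t ∈ Ico 0 T, ∀ x : α, 0 ≤ F₁ t x) → (∀ t ∈ Ico 0 T, ∀ x : α, Φf t x ≤ C₂ * (Q t x + ((T - t) ^ 2)⁻¹) * Real.sqrt |P t x| + C₂ * Real.sqrt (Q t x) * |P t x|) → (∀ t ∈ Ico 0 T, ∀ x : α, ΦF t x ≤ 3 * Cs * Real.sqrt (Q t x) * F₁ t x) → (∀ (t₁ τ K a b A₀ : ℝ), t₁ ∈ Ico 0 T → 0 < τ → t₁ + τ < T → 0 ≤ K → 0 ≤ a → 0 ≤ b → K * τ ≤ 1 → (∀ x : α, P t₁ x ≤ A₀) → (∀ t ∈ Icc t₁ (t₁ + τ), ∀ x : α, Φf t x ≤ a) → (∀ t ∈ Icc t₁ (t₁ + τ), ∀ x : α, ΦF t x ≤ K * F₁ t x + b) → ∀ t ∈ Icc t₁ (t₁ + τ), ∀ x : α, (t - t₁) * F₁ t x ≤ 2 / 2 * A₀ + τ * (τ * b + 2 * a / 2)) →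 ∃ δ₁ C₁ t₁ : ℝ, 0 < δ₁ ∧ t₁ ∈ Ico 0 T ∧ ∀ t ∈ Ico t₁ T, ∀ x : α, F₁ t x ≤ C₁ * (T - t) ^ (δ₁ - 3) := by
  intro α T δ C t₀ tQ CQ C₂ Cs R N Q P F₁ Φf ΦF hδ ht₀ htQ hC₂ hCs hrate hQ hPdef hP0 hF₁ hΦf hΦF hwin
  -- the exponent `e = δ₁` and the constants
  set e : ℝ := min δ 1 / 2 with he_def
  have hmin : 0 < min δ 1 := lt_min hδ one_pos
  have he0 : 0 < e := by positivity
  have he1 : e ≤ 1 / 2 := by have := min_le_right δ 1; linarith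
  have h2e : 2 * e ≤ δ := by have := min_le_left δ 1; linarith
  set C' : ℝ := max C 0 with hC'_def
  have hC'0 : 0 ≤ C' := le_max_right _ _
  have hCC' : C ≤ C' := le_max_left _ _
  set CQ' : ℝ := max CQ 0 with hCQ'_def
  have hCQ'0 : 0 ≤ CQ' := le_max_right _ _
  set CP : ℝ := 3 * C' + C' ^ 2 / 6 with hCP_def
  have hCP0 : 0 ≤ CP := by positivity
  set Ca : ℝ := C₂ * (CQ' + 1) * √CP + C₂ * √CQ' * CP with hCa_def
  have hCa0 : 0 ≤ Ca := by positivity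
  set L : ℝ := 6 * Cs * √CQ' with hL_def
  have hL0 : 0 ≤ L := by positivity
  set κ : ℝ := min (1 / 2) (1 / (L + 1)) with hκ_def
  have hκ0 : 0 < κ := lt_min (by norm_num) (by positivity)
  have hκ2 : κ ≤ 1 / 2 := min_le_left _ _
  have hκL : L * κ ≤ 1 := by
    have h1 : κ ≤ 1 / (L + 1) := min_le_right _ _
    have h2 : L * κ ≤ L * (1 / (L + 1)) := mul_le_mul_of_nonneg_left h1 hL0
    have h3 : L * (1 / (L + 1)) ≤ 1 := by
      rw [mul_one_div, div_le_one (by positivity)]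
      linarith
    exact h2.trans h3
  -- the late initial time `s₀`
  set s₀ : ℝ := max (max t₀ tQ) (T - 1) with hs₀_def
  have hs₀0 : 0 ≤ s₀ := ht₀.1.trans ((le_max_left _ _).trans (le_max_left _ _))
  have hs₀T : s₀ < T := max_lt (max_lt ht₀.2 htQ.2) (by linarith)
  have hmem : ∀ t ∈ Ico s₀ T, t ∈ Ico 0 T ∧ t ∈ Ico t₀ T ∧ t ∈ Ico tQ T ∧ 0 < T - t ∧ T - t ≤ 1 := by
    intro t ht
    have h1 : t₀ ≤ t := ((le_max_left _ _).trans (le_max_left _ _)).trans ht.1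
    have h2 : tQ ≤ t := ((le_max_right _ _).trans (le_max_left _ _)).trans ht.1
    have h3 : T - 1 ≤ t := (le_max_right _ _).trans ht.1
    exact ⟨⟨ht₀.1.trans h1, ht.2⟩, ⟨h1, ht.2⟩, ⟨h2, ht.2⟩, sub_pos.2 ht.2, by linarith⟩
  -- conversion of the rates: `h^γ ≤ (h^e)²` for `γ ≥ 2e`, `0 < h ≤ 1`
  have hconv : ∀ {h γ : ℝ}, 0 < h → h ≤ 1 → 2 * e ≤ γ → h ^ γ ≤ (h ^ e) ^ 2 := by
    intro h γ hh hh1 hγ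
    have : (h ^ e) ^ 2 = h ^ (2 * e) := by
      rw [mul_comm, Real.rpow_mul hh.le, Real.rpow_two]
    rw [this]
    exact Real.rpow_le_rpow_of_exponent_ge hh hh1 hγ
  -- the round defect is small on `[s₀, T)`
  have hPbd : ∀ t ∈ Ico s₀ T, ∀ x, P t x ≤ CP * ((T - t) ^ e) ^ 2 / (T - t) ^ 2 := by
    intro t ht x
    obtain ⟨-, htt₀, -, hh, hh1⟩ := hmem t ht
    obtain ⟨r1, r2, r3⟩ := hrate t htt₀ x
    have hu : 0 ≤ (T - t) ^ e := Real.rpow_nonneg hh.le e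
    have hu1 : (T - t) ^ e ≤ 1 := Real.rpow_le_one hh.le hh1 he0.le
    have c1 : C * (T - t) ^ δ ≤ C' * ((T - t) ^ e) ^ 2 :=
      (mul_le_mul_of_nonneg_right hCC' (Real.rpow_nonneg hh.le δ)).trans
        (mul_le_mul_of_nonneg_left (hconv hh hh1 h2e) hC'0)
    have c2 : C * (T - t) ^ (2 * δ) ≤ C' * ((T - t) ^ e) ^ 2 :=
      (mul_le_mul_of_nonneg_right hCC' (Real.rpow_nonneg hh.le _)).trans
        (mul_le_mul_of_nonneg_left (hconv hh hh1 (by linarith)) hC'0)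
    rw [hPdef]
    exact roundDefect_le hh hu hu1 (r1.trans c1) (r2.trans c2) (r3.trans c1)
  -- the curvature scale on `[s₀, T)`
  have hQbd : ∀ t ∈ Ico s₀ T, ∀ x, Q t x ≤ CQ' * ((T - t) ^ 2)⁻¹ := by
    intro t ht x
    obtain ⟨-, -, httQ, -, -⟩ := hmem t ht
    exact (hQ t httQ x).trans
      (mul_le_mul_of_nonneg_right (le_max_left _ _) (inv_nonneg.2 (sq_nonneg _)))
  -- the reaction term of `P` on `[s₀, T)`
  have hΦfbd : ∀ t ∈ Ico s₀ T, ∀ x, Φf t x ≤ Ca * (T - t) ^ e / (T - t) ^ 3 := by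
    intro t ht x
    obtain ⟨htT, -, -, hh, hh1⟩ := hmem t ht
    exact (hΦf t htT x).trans (roundDefect_reaction_le hh (Real.rpow_nonneg hh.le e)
      (Real.rpow_le_one hh.le hh1 he0.le) hC₂ hCP0 hCQ'0 (hP0 t htT x) (hPbd t ht x) (hQbd t ht x))
  -- the reaction term of `F₁` on `[s₀, T)`
  have hΦFbd : ∀ t ∈ Ico s₀ T, ∀ x, ΦF t x ≤ 3 * Cs * √CQ' / (T - t) * F₁ t x := by
    intro t ht x
    obtain ⟨htT, -, -, hh, -⟩ := hmem t ht
    have hsq : √(Q t x) ≤ √CQ' / (T - t) := by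
      rw [Real.sqrt_le_left (by positivity)]
      calc Q t x ≤ CQ' * ((T - t) ^ 2)⁻¹ := hQbd t ht x
        _ = (√CQ' / (T - t)) ^ 2 := by rw [div_pow, Real.sq_sqrt hCQ'0, div_eq_mul_inv]
    calc ΦF t x ≤ 3 * Cs * √(Q t x) * F₁ t x := hΦF t htT x
      _ ≤ 3 * Cs * (√CQ' / (T - t)) * F₁ t x :=
        mul_le_mul_of_nonneg_right (mul_le_mul_of_nonneg_left hsq (by positivity)) (hF₁ t htT x)
      _ = 3 * Cs * √CQ' / (T - t) * F₁ t x := by ring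
  -- the window step: `κ h₁³ F₁(t₁ + κ h₁) ≤ (C_P + 8 C_a) u₁`
  have hclaim : ∀ t₁ ∈ Ico s₀ T, ∀ x,
      κ * (T - t₁) ^ 3 * F₁ (t₁ + κ * (T - t₁)) x ≤ (CP + 8 * Ca) * (T - t₁) ^ e := by
    intro t₁ ht₁ x
    obtain ⟨ht₁T, -, -, hh₁, hh₁1⟩ := hmem t₁ ht₁
    have hu₁0 : 0 ≤ (T - t₁) ^ e := Real.rpow_nonneg hh₁.le e
    have hu₁1 : (T - t₁) ^ e ≤ 1 := Real.rpow_le_one hh₁.le hh₁1 he0.le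
    have hτ0 : 0 < κ * (T - t₁) := mul_pos hκ0 hh₁
    have hτT : t₁ + κ * (T - t₁) < T := by
      have : κ * (T - t₁) < 1 * (T - t₁) := mul_lt_mul_of_pos_right (by linarith) hh₁
      linarith
    have hK0 : 0 ≤ L / (T - t₁) := div_nonneg hL0 hh₁.le
    have hKτ : L / (T - t₁) * (κ * (T - t₁)) ≤ 1 := by
      rw [show L / (T - t₁) * (κ * (T - t₁)) = L * κ by field_simp]
      exact hκL
    have ha0 : 0 ≤ 8 * Ca * (T - t₁) ^ e / (T - t₁) ^ 3 := by positivity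
    have hA₀ : ∀ x, P t₁ x ≤ CP * ((T - t₁) ^ e) ^ 2 / (T - t₁) ^ 2 := fun x ↦ hPbd t₁ ht₁ x
    have hwmem : ∀ t ∈ Icc t₁ (t₁ + κ * (T - t₁)),
        t ∈ Ico s₀ T ∧ (T - t₁) / 2 ≤ T - t ∧ T - t ≤ T - t₁ := by
      intro t ht
      refine ⟨⟨ht₁.1.trans ht.1, ht.2.trans_lt hτT⟩, ?_, by linarith [ht.1]⟩
      have := mul_le_mul_of_nonneg_right hκ2 hh₁.le
      linarith [ht.2]
    have ha : ∀ t ∈ Icc t₁ (t₁ + κ * (T - t₁)), ∀ x,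
        Φf t x ≤ 8 * Ca * (T - t₁) ^ e / (T - t₁) ^ 3 := by
      intro t ht x
      obtain ⟨hts₀, hlow, hup⟩ := hwmem t ht
      have hh : 0 < T - t := by linarith
      refine (hΦfbd t hts₀ x).trans ?_
      rw [div_le_div_iff₀ (pow_pos hh 3) (pow_pos hh₁ 3)]
      have hue : (T - t) ^ e ≤ (T - t₁) ^ e := Real.rpow_le_rpow hh.le hup he0.le
      have hcube : (T - t₁) ^ 3 ≤ 8 * (T - t) ^ 3 := by
        have h2 : T - t₁ ≤ 2 * (T - t) := by linarith
        calc (T - t₁) ^ 3 ≤ (2 * (T - t)) ^ 3 := pow_le_pow_left₀ hh₁.le h2 3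
          _ = 8 * (T - t) ^ 3 := by ring
      calc Ca * (T - t) ^ e * (T - t₁) ^ 3 ≤ Ca * (T - t₁) ^ e * (8 * (T - t) ^ 3) :=
            mul_le_mul (mul_le_mul_of_nonneg_left hue hCa0) hcube (pow_nonneg hh₁.le 3)
              (mul_nonneg hCa0 hu₁0)
        _ = 8 * Ca * (T - t₁) ^ e * (T - t) ^ 3 := by ring
    have hb : ∀ t ∈ Icc t₁ (t₁ + κ * (T - t₁)), ∀ x, ΦF t x ≤ L / (T - t₁) * F₁ t x + 0 := by
      intro t ht x
      obtain ⟨hts₀, hlow, -⟩ := hwmem t ht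
      have hh : 0 < T - t := by linarith
      have hF0 := hF₁ t (hmem t hts₀).1 x
      rw [add_zero]
      refine (hΦFbd t hts₀ x).trans (mul_le_mul_of_nonneg_right ?_ hF0)
      rw [div_le_div_iff₀ hh hh₁, hL_def]
      have h3 : 0 ≤ 3 * Cs * √CQ' := by positivity
      have := mul_le_mul_of_nonneg_left hlow h3
      linarith
    -- the window lemma at `t = t₁ + κ h₁`
    have hw := hwin t₁ (κ * (T - t₁)) (L / (T - t₁)) (8 * Ca * (T - t₁) ^ e / (T - t₁) ^ 3) 0
      (CP * ((T - t₁) ^ e) ^ 2 / (T - t₁) ^ 2) ht₁T hτ0 hτT hK0 ha0 le_rfl hKτ hA₀ ha hb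
      (t₁ + κ * (T - t₁)) ⟨by linarith, le_rfl⟩ x
    have e1 : (t₁ + κ * (T - t₁) - t₁) * F₁ (t₁ + κ * (T - t₁)) x =
        κ * (T - t₁) * F₁ (t₁ + κ * (T - t₁)) x := by ring
    have e2 : 2 / 2 * (CP * ((T - t₁) ^ e) ^ 2 / (T - t₁) ^ 2) + κ * (T - t₁) *
        (κ * (T - t₁) * 0 + 2 * (8 * Ca * (T - t₁) ^ e / (T - t₁) ^ 3) / 2) =
        (CP * ((T - t₁) ^ e) ^ 2 + 8 * κ * Ca * (T - t₁) ^ e) / (T - t₁) ^ 2 := by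
      field_simp
      ring
    rw [e1, e2, le_div_iff₀ (pow_pos hh₁ 2)] at hw
    have hu₁sq : ((T - t₁) ^ e) ^ 2 ≤ (T - t₁) ^ e := pow_le_of_le_one hu₁0 hu₁1 two_ne_zero
    have hq1 : CP * ((T - t₁) ^ e) ^ 2 ≤ CP * (T - t₁) ^ e := mul_le_mul_of_nonneg_left hu₁sq hCP0
    have hq2 : 8 * κ * Ca * (T - t₁) ^ e ≤ 8 * Ca * (T - t₁) ^ e := by
      have h8 : 0 ≤ 8 * Ca * (T - t₁) ^ e := by positivity
      have := mul_le_mul_of_nonneg_right (show κ ≤ 1 by linarith) h8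
      linarith
    linarith only [hw, hq1, hq2]
  -- conclusion: every late time is the end of a window
  have hsT : 0 < T - s₀ := sub_pos.2 hs₀T
  have hs₁T : s₀ + κ * (T - s₀) < T := by
    have : κ * (T - s₀) < 1 * (T - s₀) := mul_lt_mul_of_pos_right (by linarith) hsT
    linarith
  refine ⟨e, 2 * (CP + 8 * Ca) / κ, s₀ + κ * (T - s₀), he0,
    ⟨add_nonneg hs₀0 (mul_nonneg hκ0.le hsT.le), hs₁T⟩, fun t ht x ↦ ?_⟩
  have h1κ : 0 < 1 - κ := by linarith
  have hh : 0 < T - t := sub_pos.2 ht.2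
  obtain ⟨t₁, ht₁_def⟩ : ∃ t₁ : ℝ, t₁ = (t - κ * T) / (1 - κ) := ⟨_, rfl⟩
  have ht₁t : t₁ + κ * (T - t₁) = t := by rw [ht₁_def]; field_simp; ring
  have hTt₁ : T - t₁ = (T - t) / (1 - κ) := by rw [ht₁_def]; field_simp; ring
  have ht₁s₀ : s₀ ≤ t₁ := by
    rw [ht₁_def, le_div_iff₀ h1κ]
    linarith [ht.1]
  have ht₁T : t₁ < T := by
    rw [ht₁_def, div_lt_iff₀ h1κ]
    linarith [ht.2]
  have hc := hclaim t₁ ⟨ht₁s₀, ht₁T⟩ x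
  rw [ht₁t] at hc
  have hh₁ : 0 < T - t₁ := sub_pos.2 ht₁T
  have hle : T - t ≤ T - t₁ := by
    rw [hTt₁, le_div_iff₀ h1κ]
    have := mul_nonneg hh.le hκ0.le
    linarith
  have hle2 : T - t₁ ≤ 2 * (T - t) := by
    rw [hTt₁, div_le_iff₀ h1κ]
    have := mul_le_mul_of_nonneg_left (show 1 / 2 ≤ 1 - κ by linarith)
      (show (0 : ℝ) ≤ 2 * (T - t) by linarith)
    linarith
  have hF0 : 0 ≤ F₁ t x :=
    hF₁ t ⟨hs₀0.trans ((le_add_of_nonneg_right (mul_nonneg hκ0.le hsT.le)).trans ht.1), ht.2⟩ x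
  have hu : 0 ≤ (T - t) ^ e := Real.rpow_nonneg hh.le e
  have hu₁ : (T - t₁) ^ e ≤ 2 * (T - t) ^ e := by
    calc (T - t₁) ^ e ≤ (2 * (T - t)) ^ e := Real.rpow_le_rpow hh₁.le hle2 he0.le
      _ = 2 ^ e * (T - t) ^ e := Real.mul_rpow (by norm_num) hh.le
      _ ≤ 2 * (T - t) ^ e := by
        refine mul_le_mul_of_nonneg_right ?_ hu
        calc (2 : ℝ) ^ e ≤ 2 ^ (1 : ℝ) := Real.rpow_le_rpow_of_exponent_le (by norm_num) (by linarith)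
          _ = 2 := Real.rpow_one 2
  have hcube : (T - t) ^ 3 ≤ (T - t₁) ^ 3 := pow_le_pow_left₀ hh.le hle 3
  have hmain : κ * (T - t) ^ 3 * F₁ t x ≤ 2 * (CP + 8 * Ca) * (T - t) ^ e := by
    calc κ * (T - t) ^ 3 * F₁ t x ≤ κ * (T - t₁) ^ 3 * F₁ t x :=
          mul_le_mul_of_nonneg_right (mul_le_mul_of_nonneg_left hcube hκ0.le) hF0
      _ ≤ (CP + 8 * Ca) * (T - t₁) ^ e := hc
      _ ≤ (CP + 8 * Ca) * (2 * (T - t) ^ e) := mul_le_mul_of_nonneg_left hu₁ (by positivity)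
      _ = 2 * (CP + 8 * Ca) * (T - t) ^ e := by ring
  rw [Real.rpow_sub hh, Real.rpow_ofNat, mul_div_assoc', le_div_iff₀ (pow_pos hh 3),
    div_mul_eq_mul_div, le_div_iff₀ hκ0]
  linarith [hmain]

end Endgame


end Summit.SmoothPoincare4.SmoothPoincare4.Theorems.MargerinRails

end
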